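import Mathlib
import Summits.Ventures.HodgeRepro.Tier4.Line1.SecondCountableGA
import Summits.Ventures.HodgeRepro.Tier4.Line1.LocallyCompactGA
import Summits.Ventures.HodgeRepro.Tier4.Line1.SigmaCompactGA
import Summits.Ventures.HodgeRepro.Tier4.Line4.AdaptedONBAdaptedClosed
import Summits.Ventures.HodgeRepro.Tier4.Line4.L1ClosedCor

/-!
# Tier4/Line4/ONBClosedL1 — C-L4-ONBCLOSED (plan-4 g4's (K2), lead S14968): an adapted ONB of CLOSED constituents,
stable under `R(f)` for `L¹` tests

Blind re-derivation cell `pub-hodge-repro`, Tier 4 «prove the step» (README §9–§10), seat t4-L2-p2 g4.  GLUE of two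
tree theorems: L4-p1's `exists_adaptedONB_adaptedC` (AdaptedONBAdaptedClosed p687172 — under the glue's `hinf` and the
(4b) print `h4bC`, an adapted ONB whose constituents are all `IsClosedSub`; taken with the trivial block functor
`Wfd := ⊥`) and this seat's `L1Class.adaptedClosedUnderL1_of_isClosedSub` (L1ClosedCor p700295 — closed invariant
constituents are stable under `R(f)` for every `L¹` test).  Display (4) of v0.33 (`AdaptedClosedUnderL1` for the
family) therefore needs no clause beyond `hinf` and `h4bC`: `exists_adaptedONB_closed_underL1` (abstract setting;
binders `SecondCountableTopology G`, `LocallyCompactSpace G`, `SigmaCompactSpace G`) and its instance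
`exists_adaptedONB_closed_underL1_GA` on any setting over `G(𝔸_k)` (the three instances are L1's
`secondCountable_GA`, `locallyCompact_GA`, `sigmaCompact_GA`).  No printed input beyond the displayed `h4bC`, which is
L4-p1's hypothesis verbatim.  HC_CM is NOT proved by anyone in this repository.
-/

set_option autoImplicit false
noncomputable section

namespace Summit.Ventures.HodgeRepro.Tier4.Line4

open MeasureTheory Summit.Ventures.HodgeRepro.Tier4.Common Summit.Ventures.HodgeRepro.Tier4.Line1
  Summit.Ventures.HodgeRepro.Tier4.Line1.RTF

section Abstract

variable {G : Type} [Group G] [TopologicalSpace G] [IsTopologicalGroup G] [MeasurableSpace G] [BorelSpace G]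
  (S : RTF.Setting G)

/-- **C-L4-ONBCLOSED (abstract)**: under `hinf` and the (4b) print, there is an adapted ONB whose constituents are all
closed and stable under `R(f)` for every `L¹` test function. -/
theorem exists_adaptedONB_closed_underL1 [SecondCountableTopology G] [LocallyCompactSpace G]
    [SigmaCompactSpace G] (hinf : ¬ FiniteDimensional ℂ (Lp ℂ 2 (S.μ.restrict S.DG)))
    (h4bC : ∀ V : Set (G → ℂ), S.IsInvariantSubspace V →
      (∀ ψ : G → ℂ, Continuous ψ → S.Invariant ψ →
        (∀ ε : ℝ, 0 < ε → ∃ ψ' ∈ V,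
          eLpNorm (fun x => ψ x - ψ' x) 2 (S.μ.restrict S.DG) < ENNReal.ofReal ε) → ψ ∈ V) →
      (∃ ψ ∈ V, ∃ x, ψ x ≠ 0) →
      ∃ V' : Set (G → ℂ), S.IsInvariantSubspace V' ∧ V' ⊆ V ∧ S.IsIrreducible V' ∧
        (∃ ψ ∈ V', ∃ x, ψ x ≠ 0) ∧ IsClosedSub S V') :
    ∃ (τ : ℕ → Set (G → ℂ)) (φ : ℕ → G → ℂ) (n : ℕ → ℕ), S.IsAdaptedONB τ φ n ∧
      (∀ m, IsClosedSub S (τ m)) ∧ L1Class.AdaptedClosedUnderL1 S τ := by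
  obtain ⟨τ, φ, n, hONB, hcl, -⟩ := exists_adaptedONB_adaptedC S hinf h4bC (fun _ => ⊥)
    (fun V _ _ _ h0 => ⟨by simpa only [Submodule.bot_coe, Set.singleton_subset_iff] using h0, inferInstance⟩)
  exact ⟨τ, φ, n, hONB, hcl, L1Class.adaptedClosedUnderL1_of_isClosedSub S τ hONB.inv hcl⟩

end Abstract

section Adelic

variable {k : Type} [Field k] [NumberField k] (W : PlaneData k) [MeasurableSpace (GA W)] [BorelSpace (GA W)]
  (S : RTF.Setting (GA W))

/-- **C-L4-ONBCLOSED on `G(𝔸_k)`** (any setting over the adelic group of a plane, in particular the seesaw setting):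
the instance binders are L1's theorems. -/
theorem exists_adaptedONB_closed_underL1_GA (hinf : ¬ FiniteDimensional ℂ (Lp ℂ 2 (S.μ.restrict S.DG)))
    (h4bC : ∀ V : Set (GA W → ℂ), S.IsInvariantSubspace V →
      (∀ ψ : GA W → ℂ, Continuous ψ → S.Invariant ψ →
        (∀ ε : ℝ, 0 < ε → ∃ ψ' ∈ V,
          eLpNorm (fun x => ψ x - ψ' x) 2 (S.μ.restrict S.DG) < ENNReal.ofReal ε) → ψ ∈ V) →
      (∃ ψ ∈ V, ∃ x, ψ x ≠ 0) →
      ∃ V' : Set (GA W → ℂ), S.IsInvariantSubspace V' ∧ V' ⊆ V ∧ S.IsIrreducible V' ∧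
        (∃ ψ ∈ V', ∃ x, ψ x ≠ 0) ∧ IsClosedSub S V') :
    ∃ (τ : ℕ → Set (GA W → ℂ)) (φ : ℕ → GA W → ℂ) (n : ℕ → ℕ), S.IsAdaptedONB τ φ n ∧
      (∀ m, IsClosedSub S (τ m)) ∧ L1Class.AdaptedClosedUnderL1 S τ :=
  haveI := secondCountable_GA W
  haveI := locallyCompact_GA W
  haveI := sigmaCompact_GA W
  exists_adaptedONB_closed_underL1 S hinf h4bC

end Adelic

end Summit.Ventures.HodgeRepro.Tier4.Line4

end
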